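import Literature.NumberTheory.LFunctions.SmoothedExplicitFormulaContour
import Literature.NumberTheory.LFunctions.FordZetaLogDerivLeftLine
import HarnessLib

/-!
# The remainder of Ford's smoothed explicit formula: `|E| ≤ D(1.17 + ⅓ log t)`, `|E| ≤ 1.28 D`

Topic `Literature/NumberTheory/LFunctions`, family RH (explicit Vinogradov–Korobov zero-free
regions). Everything in this file is PROVED; no definition and no named fact is introduced.

K. Ford, *Zero-free regions for the Riemann zeta function* (2002), **Lemma 4.5**: for an admissible
smoothing `f` with `|F₀(z)| ≤ D/|z|²` (`F₀ = F − f(0)/z`),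
`K(s) = Σ Λ(n) n^{−s} f(log n) = −f(0) ζ'/ζ(s) − Σ_ρ F₀(s−ρ) + F₀(s−1) + E`,
`|E| ≤ D(1.72 + ⅓ log(1 + Im s))`, where `E = (1/2πi)∫_{(−1/2)} (−ζ'/ζ)(w) F₀(s − w) dw`. The tree
has the identity with `E = smoothedEFRemainder f s` (`SmoothedEF.fordK_eq_explicit`,
`SmoothedExplicitFormulaContour.lean`, for the `C²` smoothings `IsSmoothedEFTest`) and Ford's
Lemma 3.2 (`FordL32.norm_logDeriv_zeta_left_le`, `|ζ'/ζ(−½ + iu)| ≤ 4.62 + ½ log(1 + u²/9)`). This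
file bounds `E`, in the two forms consumed by Ford's **Lemma 4.6** (= Mossinghoff–Trudgian–Yang
Lemma 4.2):

* `FordRemainder.norm_smoothedEFRemainder_one_add_le` — for `s = 1 + it`, `t ≥ 6`:
  `‖E‖ ≤ D (1.17 + ⅓ log t)`;
* `FordRemainder.norm_smoothedEFRemainder_real_le` — for real `s = σ ∈ [1, 3/2)`: `‖E‖ ≤ 1.28 D`;

for every `D ≥ 0` with `‖F₀(z)‖ ≤ D/‖z‖²` on `Re z ≥ 3/2` (for Ford's smoothings, (4.5) with
`η ≤ 3/2`). Ford's constants are `1.72 + ⅓ log(1+t)` and `1.72` (really `1.771`, see the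
faithfulness note of `FordExplicitFormulaError.lean`, which bounds Ford's error integral
`∫ (4.62 + ½ log(1 + v²/9))/(c² + (t − v)²) dv` as printed); the sharper values here come from an
exact cancellation which the termwise treatment gives away:

* `FordRemainder.integral_logDeriv_three_halves_mul_fordLaplace₀_eq_zero` — **the reflected prime side
  vanishes**: `∫_ℝ (ζ'/ζ)(3/2 − iy) F₀(s + ½ − iy) dy = 0` (`Re s > −½`). Indeed
  `ζ'/ζ(3/2 − iy) = −Σ Λ(n) n^{−3/2+iy}` and, term by term, `(1/2πi)∫_{(c)} n^{−u} F₀(u) du`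
  (`c = Re s + ½ > 0`) is the Mellin inverse at the point `n ≥ 1` of
  `φ₀(x) = f(max(−log x, 0)) − f(0)`, whose Mellin transform on `Re u > 0` is `F₀`
  (`FordRemainder.mellin_lift₀`) and which vanishes on `[1, ∞)` (`FordRemainder.integral_cpow_neg_mul_fordLaplace₀_eq_zero`,
  Mathlib's `mellinInv_mellin_eq`; the tree's `integral_cpow_mul_fordLaplace₀_eq` is the companion
  statement on `Re u < 0`).
* Hence, by the functional equation in the form `FordL32.logDeriv_zeta_left_eq`
  (`ζ'/ζ(−½+iy) = −ζ'/ζ(3/2−iy) + log π − Re ψ(¾ + iy/2) + 1/(−½+iy)`), only the `Γ`-piece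
  `V(y) = log π − Re ψ(¾ + iy/2) + 1/(−½ + iy)` enters: `2πE = −∫ V(y) F₀(s + ½ − iy) dy`, and
  `‖V(y)‖ ≤ 2.57 + ½ log(1 + y²/9)` (`FordRemainder.norm_gammaPiece_le`, the three ranges of the tree's
  proof of Lemma 3.2 without the term `|ζ'/ζ(3/2 − iy)| < 2`).
* The Lorentzian integrals: `∫ dy/(a² + (t−y)²) = π/a` and the crude tail bound
  `∫_ℝ log(1 + y²/a)/(9/4 + y²) dy ≤ (2π/3) log(1 + 16/a) + log 4 + 1` (`a ≥ 16/15`; split at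
  `|y| = 4`, `∫_4^∞ 2 log y/y² dy = (log 4 + 1)/2`), with `log(1 + y²/9) ≤ log(1 + 2t²/9) + log(1 + 2(y−t)²/9)`
  for the shifted kernel.

## References

* K. Ford, *Zero-free regions for the Riemann zeta function*, Number Theory for the Millennium II
  (Urbana 2000), A K Peters 2002, 25–56 (arXiv:1910.08205): Lemma 3.2, Lemma 4.5 and its proof
  ((4.7)–(4.8)), Lemma 4.6. [Ford2002Millennium]
* M. J. Mossinghoff, T. S. Trudgian, A. Yang, *Explicit zero-free regions for the Riemann
  zeta-function*, Res. Number Theory 10 (2024) = arXiv:2212.06867: Lemma 4.2. [MossinghoffTrudgianYangRNT2024]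
-/

noncomputable section

open Complex Real MeasureTheory Set Filter Asymptotics ArithmeticFunction Topology
open scoped LSeries.notation

namespace Literature.NumberTheory.LFunctions

namespace FordRemainder

open Literature.Analysis.SpecialFunctions.Complex

/-! ### Mellin inversion on `Re u = c > 0`: `∫ n^{−(c+iy)} F₀(c+iy) dy = 0` for `n ≥ 1` -/

/-- The substitution `x = e^{−y}` in a Mellin transform: `∫₀^∞ x^{u−1} g(x) dx = ∫_ℝ e^{−uy} g(e^{−y}) dy`
(both sides `0` together when divergent). [folklore] -/
theorem mellin_eq_integral_exp_neg (g : ℝ → ℂ) (u : ℂ) :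
    mellin g u = ∫ y : ℝ, Complex.exp (-(u * y)) * g (Real.exp (-y)) := by
  have himg : (Real.exp ∘ Neg.neg) '' (univ : Set ℝ) = Ioi 0 := by
    rw [Set.image_comp, Set.image_univ_of_surjective neg_surjective, Set.image_univ, Real.range_exp]
  have hderiv : ∀ x ∈ (univ : Set ℝ),
      HasDerivWithinAt (Real.exp ∘ Neg.neg) (-Real.exp (-x)) univ x := fun x _ ↦ by
    exact (((Real.hasDerivAt_exp (-x)).comp x (hasDerivAt_neg x)).congr_deriv
      (by ring)).hasDerivWithinAt
  have hinj : (univ : Set ℝ).InjOn (Real.exp ∘ Neg.neg) :=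
    (Real.exp_injective.comp neg_injective).injOn
  rw [mellin, ← himg, integral_image_eq_integral_abs_deriv_smul MeasurableSet.univ hderiv hinj]
  simp only [Measure.restrict_univ, Function.comp_apply, abs_neg, abs_of_pos (Real.exp_pos _)]
  refine integral_congr_ae (Eventually.of_forall fun y ↦ ?_)
  simp only [smul_eq_mul, Complex.real_smul]
  have hexp : ((Real.exp (-y) : ℝ) : ℂ) = Complex.exp (-(y : ℂ)) := by push_cast; rfl
  rw [hexp, ← mul_assoc]
  congr 1
  rw [cpow_def_of_ne_zero (Complex.exp_ne_zero _), Complex.log_exp (by simp [Real.pi_pos])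
    (by simpa using Real.pi_pos.le), ← Complex.exp_add]
  congr 1
  ring

/-- For `f` continuous vanishing on `[x₀, ∞)` and `Re u > 0`, the Mellin transform of
`φ₀(x) = f(max(−log x, 0)) − f(0)` converges absolutely: `φ₀ = 0` on `[1, ∞)` and `φ₀ = −f(0)` near
`0`. [folklore] -/
theorem mellinConvergent_lift₀ {f : ℝ → ℝ} {x₀ : ℝ} (hfc : Continuous f)
    (hf0 : ∀ u, x₀ ≤ u → f u = 0) {u : ℂ} (hu : 0 < u.re) :
    MellinConvergent (fun x ↦ smoothedEFLift f x - (f 0 : ℂ)) u := by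
  refine mellinConvergent_of_isBigO_rpow (a := u.re + 1) (b := 0) ?_ ?_ (by linarith) ?_
    (by simpa using hu)
  · exact ((continuousOn_smoothedEFLift hfc).sub continuousOn_const).locallyIntegrableOn
      measurableSet_Ioi
  · refine IsBigO.of_bound 0 ?_
    filter_upwards [Ici_mem_atTop (1 : ℝ)] with t ht
    rw [smoothedEFLift_of_one_le f ht, sub_self, norm_zero, zero_mul]
  · refine IsBigO.of_bound ‖(f 0 : ℂ)‖ ?_
    filter_upwards [Ioo_mem_nhdsGT (Real.exp_pos (-x₀))] with t ht
    rw [smoothedEFLift_eq_zero hf0 ht.1 ht.2, zero_sub, norm_neg, neg_zero, Real.rpow_zero,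
      Real.norm_eq_abs, abs_one, mul_one]

/-- **`mellin φ₀ (u) = F₀(u)` for `Re u > 0`**, `φ₀(x) = f(max(−log x, 0)) − f(0)`:
`∫₀^∞ e^{−uy}(f(y) − f(0)) dy = F(u) − f(0)/u`. [folklore] -/
theorem mellin_lift₀ {f : ℝ → ℝ} {x₀ : ℝ} (hfc : Continuous f)
    (hf0 : ∀ u, x₀ ≤ u → f u = 0) (hx₀ : 0 ≤ x₀) {u : ℂ} (hu : 0 < u.re) :
    mellin (fun x ↦ smoothedEFLift f x - (f 0 : ℂ)) u = fordLaplace₀ f u := by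
  rw [mellin_eq_integral_exp_neg]
  have hint_eq : (fun y : ℝ ↦ Complex.exp (-(u * y)) * (smoothedEFLift f (Real.exp (-y)) - (f 0 : ℂ))) =
      fun y : ℝ ↦ Complex.exp (-(u * y)) * ((f (max y 0) : ℂ) - (f 0 : ℂ)) := by
    funext y; rw [smoothedEFLift_exp_neg]
  rw [hint_eq]
  have hu' : (-u).re < 0 := by simpa using hu
  -- the two half-lines
  have hIic : IntegrableOn (fun y : ℝ ↦ Complex.exp (-(u * y)) * ((f (max y 0) : ℂ) - (f 0 : ℂ)))
      (Iic 0) := by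
    refine integrableOn_zero.congr_fun (fun y hy ↦ ?_) measurableSet_Iic
    rw [mem_Iic] at hy
    simp [max_eq_right hy]
  have hA : IntegrableOn (fun y : ℝ ↦ Complex.exp (-(u * y)) * (f (max y 0) : ℂ)) (Ioi 0) :=
    integrableOn_Ioi_smoothedEF hfc hf0 hx₀ u
  have hB : IntegrableOn (fun y : ℝ ↦ Complex.exp (-u * y) * (f 0 : ℂ)) (Ioi 0) :=
    (integrableOn_exp_mul_complex_Ioi hu' 0).mul_const (f 0 : ℂ)
  have hIoi : IntegrableOn (fun y : ℝ ↦ Complex.exp (-(u * y)) * ((f (max y 0) : ℂ) - (f 0 : ℂ)))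
      (Ioi 0) := by
    refine (hA.sub hB).congr_fun (fun y _ ↦ ?_) measurableSet_Ioi
    simp only [Pi.sub_apply, neg_mul]; ring
  rw [← intervalIntegral.integral_Iic_add_Ioi hIic hIoi]
  have h1 : ∫ y in Iic (0 : ℝ), Complex.exp (-(u * y)) * ((f (max y 0) : ℂ) - (f 0 : ℂ)) = 0 := by
    refine setIntegral_eq_zero_of_forall_eq_zero fun y hy ↦ ?_
    rw [mem_Iic] at hy
    simp [max_eq_right hy]
  have h2 : ∫ y in Ioi (0 : ℝ), Complex.exp (-(u * y)) * ((f (max y 0) : ℂ) - (f 0 : ℂ)) =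
      fordLaplace f u - (f 0 : ℂ) / u := by
    have e : ∫ y in Ioi (0 : ℝ), Complex.exp (-(u * y)) * ((f (max y 0) : ℂ) - (f 0 : ℂ)) =
        (∫ y in Ioi (0 : ℝ), Complex.exp (-(u * y)) * (f (max y 0) : ℂ)) -
          ∫ y in Ioi (0 : ℝ), Complex.exp (-u * y) * (f 0 : ℂ) := by
      rw [← integral_sub hA hB]
      refine setIntegral_congr_fun measurableSet_Ioi fun y _ ↦ ?_
      simp only [neg_mul]; ring
    rw [e]
    have hF : ∫ y in Ioi (0 : ℝ), Complex.exp (-(u * y)) * (f (max y 0) : ℂ) = fordLaplace f u := by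
      unfold fordLaplace
      refine setIntegral_congr_fun measurableSet_Ioi fun y hy ↦ ?_
      rw [mem_Ioi] at hy
      simp [max_eq_left hy.le]
    have hC : ∫ y in Ioi (0 : ℝ), Complex.exp (-u * y) * (f 0 : ℂ) = (f 0 : ℂ) / u := by
      rw [integral_mul_const, integral_exp_mul_complex_Ioi hu' 0]
      have hu0 : u ≠ 0 := by intro h; rw [h] at hu; simp at hu
      simp only [ofReal_zero, mul_zero, Complex.exp_zero]
      field_simp
    rw [hF, hC]
  rw [h1, h2, zero_add, fordLaplace₀]

/-- **Mellin inversion on a line `Re u = c > 0`**: if `F₀` is integrable on the line then for every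
`n ≥ 1`, `∫_ℝ n^{−(c+iy)} F₀(c+iy) dy = 2π φ₀(n) = 0` (Mathlib's `mellinInv_mellin_eq` for
`φ₀(x) = f(max(−log x, 0)) − f(0)` at the point `x = n`, where `φ₀` vanishes). Companion of the
tree's `integral_cpow_mul_fordLaplace₀_eq` (`c < 0`, value `2π f(log n)`). [folklore] -/
theorem integral_cpow_neg_mul_fordLaplace₀_eq_zero {f : ℝ → ℝ} {x₀ : ℝ} (hfc : Continuous f)
    (hf0 : ∀ u, x₀ ≤ u → f u = 0) (hx₀ : 0 ≤ x₀) {c : ℝ} (hc : 0 < c)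
    (hint : Integrable fun y : ℝ ↦ fordLaplace₀ f (c + y * I)) {n : ℕ} (hn : 1 ≤ n) :
    ∫ y : ℝ, (n : ℂ) ^ (-((c : ℂ) + y * I)) * fordLaplace₀ f (c + y * I) = 0 := by
  set g : ℝ → ℂ := fun x ↦ smoothedEFLift f x - (f 0 : ℂ) with hg
  have hx : (0 : ℝ) < (n : ℝ) := by exact_mod_cast hn
  have hmel : ∀ y : ℝ, mellin g (c + y * I) = fordLaplace₀ f (c + y * I) :=
    fun y ↦ mellin_lift₀ hfc hf0 hx₀ (by simpa using hc)
  have hconv : MellinConvergent g c := mellinConvergent_lift₀ hfc hf0 (by simpa using hc)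
  have hvert : VerticalIntegrable (mellin g) c := by
    unfold VerticalIntegrable
    exact hint.congr (Eventually.of_forall fun y ↦ (hmel y).symm)
  have hga : ContinuousAt g (n : ℝ) := (continuousAt_smoothedEFLift hfc hx).sub continuousAt_const
  have key := mellinInv_mellin_eq c g hx hconv hvert hga
  have hgn : g (n : ℝ) = 0 := by
    simp only [hg]
    rw [smoothedEFLift_of_one_le f (by exact_mod_cast hn), sub_self]
  rw [hgn, mellinInv] at key
  simp_rw [hmel, smul_eq_mul] at key
  have h2π : (1 / (2 * π) : ℝ) ≠ 0 := by positivity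
  have key' := (smul_eq_zero.1 key).resolve_left h2π
  simpa using key'

/-! ### The reflected prime side vanishes: `∫ (ζ'/ζ)(3/2 − iy) F₀(s + ½ − iy) dy = 0` -/

/-- Term by term: for `Re s > −½`, `c = Re s + ½`, `F₀` integrable on `Re u = c`, and `n ≥ 1`,
`∫_ℝ n^{−(3/2 − iy)} F₀(s − (−½ + iy)) dy = 0` (substitute `y ↦ Im s − y`, then
`integral_cpow_neg_mul_fordLaplace₀_eq_zero`). [cite: Ford2002Millennium, Lemma 4.5 (proof)] -/
theorem integral_term_reflected_eq_zero {f : ℝ → ℝ} {x₀ : ℝ} (hfc : Continuous f)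
    (hf0 : ∀ u, x₀ ≤ u → f u = 0) (hx₀ : 0 ≤ x₀) {s : ℂ} (hs : -(1 / 2) < s.re)
    (hint : Integrable fun y : ℝ ↦ fordLaplace₀ f ((s.re + 1 / 2 : ℝ) + y * I)) {n : ℕ} (hn : 1 ≤ n) :
    ∫ y : ℝ, (n : ℂ) ^ (-(((3 / 2 : ℝ) : ℂ) + (-y) * I)) *
      fordLaplace₀ f (s - (((-(1 / 2) : ℝ) : ℂ) + y * I)) = 0 := by
  set c : ℝ := s.re + 1 / 2 with hc_def
  have hc : 0 < c := by rw [hc_def]; linarith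
  have hn0 : (n : ℂ) ≠ 0 := by exact_mod_cast (by omega : n ≠ 0)
  set A : ℂ := ((c - 3 / 2 : ℝ) : ℂ) + (s.im : ℂ) * I with hA
  set G : ℝ → ℂ := fun v ↦ (n : ℂ) ^ A * ((n : ℂ) ^ (-((c : ℂ) + v * I)) * fordLaplace₀ f (c + v * I))
    with hG
  have h1 : ∀ y : ℝ, (n : ℂ) ^ (-(((3 / 2 : ℝ) : ℂ) + (-y) * I)) *
      fordLaplace₀ f (s - (((-(1 / 2) : ℝ) : ℂ) + y * I)) = G (s.im - y) := by
    intro y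
    have harg : s - (((-(1 / 2) : ℝ) : ℂ) + y * I) = (c : ℂ) + ((s.im - y : ℝ) : ℂ) * I := by
      apply Complex.ext
      · simp [hc_def]
      · simp
    have hexp : -(((3 / 2 : ℝ) : ℂ) + (-y) * I) = A + -((c : ℂ) + ((s.im - y : ℝ) : ℂ) * I) := by
      apply Complex.ext
      · simp [hA]; ring
      · simp [hA]
    simp only [hG]
    rw [harg, hexp, cpow_add _ _ hn0, mul_assoc]
  simp_rw [h1]
  rw [integral_sub_left_eq_self G volume s.im]
  simp only [hG]
  rw [integral_const_mul, integral_cpow_neg_mul_fordLaplace₀_eq_zero hfc hf0 hx₀ hc hint hn, mul_zero]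

/-- `‖Λ(n) n^{−(3/2 − iy)}‖ = ‖Λ(n) n^{−3/2}‖`. [folklore] -/
theorem norm_term_reflected (n : ℕ) (y : ℝ) :
    ‖LSeries.term (fun n ↦ ((Λ n : ℝ) : ℂ)) (((3 / 2 : ℝ) : ℂ) + (-y) * I) n‖
      = ‖LSeries.term (fun n ↦ ((Λ n : ℝ) : ℂ)) ((3 / 2 : ℝ) : ℂ) n‖ := by
  simp [LSeries.norm_term_eq]

/-- The summable majorant `Σ ‖Λ(n) n^{−3/2}‖`. [folklore] -/
theorem summable_norm_term_three_halves :
    Summable fun n ↦ ‖LSeries.term (fun n ↦ ((Λ n : ℝ) : ℂ)) ((3 / 2 : ℝ) : ℂ) n‖ :=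
  summable_norm_iff.mpr (ArithmeticFunction.LSeriesSummable_vonMangoldt (by simp; norm_num))

/-- `y ↦ Σ Λ(n) n^{−(3/2 − iy)}` is continuous. [folklore] -/
theorem continuous_LSeries_reflected :
    Continuous fun y : ℝ ↦ L (fun n ↦ ((Λ n : ℝ) : ℂ)) (((3 / 2 : ℝ) : ℂ) + (-y) * I) := by
  refine continuous_tsum (fun n ↦ ?_) summable_norm_term_three_halves
    fun n y ↦ (norm_term_reflected n y).le
  rcases Nat.eq_zero_or_pos n with rfl | hn
  · simp only [LSeries.term_zero]
    exact continuous_const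
  · simp only [LSeries.term_of_ne_zero hn.ne']
    have hn0 : (n : ℂ) ≠ 0 := by exact_mod_cast hn.ne'
    refine continuous_const.div ((by fun_prop :
      Continuous fun y : ℝ ↦ ((3 / 2 : ℝ) : ℂ) + (-y) * I).const_cpow (Or.inl hn0)) fun y ↦ ?_
    exact cpow_ne_zero_iff.mpr (Or.inl hn0)

/-- `‖Σ Λ(n) n^{−(3/2 − iy)}‖ ≤ Σ ‖Λ(n) n^{−3/2}‖`. [folklore] -/
theorem norm_LSeries_reflected_le (y : ℝ) :
    ‖L (fun n ↦ ((Λ n : ℝ) : ℂ)) (((3 / 2 : ℝ) : ℂ) + (-y) * I)‖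
      ≤ ∑' n, ‖LSeries.term (fun n ↦ ((Λ n : ℝ) : ℂ)) ((3 / 2 : ℝ) : ℂ) n‖ := by
  have hsum' : Summable fun n ↦ ‖LSeries.term (fun n ↦ ((Λ n : ℝ) : ℂ)) (((3 / 2 : ℝ) : ℂ) + (-y) * I) n‖ := by
    simpa only [norm_term_reflected] using summable_norm_term_three_halves
  refine (norm_tsum_le_tsum_norm hsum').trans_eq (tsum_congr fun n ↦ ?_)
  exact norm_term_reflected n y

/-- `y ↦ F₀(s − (−½ + iy))` is integrable when `F₀` is integrable on `Re u = Re s + ½`. [folklore] -/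
theorem integrable_fordLaplace₀_reflected {f : ℝ → ℝ} {s : ℂ}
    (hint : Integrable fun y : ℝ ↦ fordLaplace₀ f ((s.re + 1 / 2 : ℝ) + y * I)) :
    Integrable fun y : ℝ ↦ fordLaplace₀ f (s - (((-(1 / 2) : ℝ) : ℂ) + y * I)) := by
  have h := hint.comp_sub_left s.im
  refine h.congr (Eventually.of_forall fun y ↦ ?_)
  have harg : s - (((-(1 / 2) : ℝ) : ℂ) + y * I) = ((s.re + 1 / 2 : ℝ) : ℂ) + ((s.im - y : ℝ) : ℂ) * I := by
    apply Complex.ext <;> simp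
  simp only [harg]

/-- **The reflected prime side vanishes**: for `f` continuous vanishing on `[x₀, ∞)`, `Re s > −½`
and `F₀` integrable on `Re u = Re s + ½`,
`∫_ℝ (Σ Λ(n) n^{−(3/2 − iy)}) F₀(s − (−½ + iy)) dy = 0` (term by term, absolutely convergent
double sum/integral). [cite: Ford2002Millennium, Lemma 4.5 (proof)] -/
theorem integral_LSeries_reflected_mul_fordLaplace₀_eq_zero {f : ℝ → ℝ} {x₀ : ℝ}
    (hfc : Continuous f) (hf0 : ∀ u, x₀ ≤ u → f u = 0) {s : ℂ} (hs : -(1 / 2) < s.re)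
    (hint : Integrable fun y : ℝ ↦ fordLaplace₀ f ((s.re + 1 / 2 : ℝ) + y * I)) :
    ∫ y : ℝ, L (fun n ↦ ((Λ n : ℝ) : ℂ)) (((3 / 2 : ℝ) : ℂ) + (-y) * I) *
      fordLaplace₀ f (s - (((-(1 / 2) : ℝ) : ℂ) + y * I)) = 0 := by
  have hf1 : ∀ u, max x₀ 0 ≤ u → f u = 0 := fun u hu ↦ hf0 u ((le_max_left _ _).trans hu)
  have hx₁ : 0 ≤ max x₀ 0 := le_max_right _ _
  have hF := integrable_fordLaplace₀_reflected hint
  set Fn : ℕ → ℝ → ℂ := fun n y ↦ LSeries.term (fun n ↦ ((Λ n : ℝ) : ℂ)) (((3 / 2 : ℝ) : ℂ) + (-y) * I) n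
    * fordLaplace₀ f (s - (((-(1 / 2) : ℝ) : ℂ) + y * I)) with hFn
  have hF_int : ∀ n, Integrable (Fn n) := by
    intro n
    rcases Nat.eq_zero_or_pos n with rfl | hn
    · simp only [hFn, LSeries.term_zero, zero_mul]
      exact integrable_zero _ _ _
    have hn0 : (n : ℂ) ≠ 0 := by exact_mod_cast hn.ne'
    have hcont : Continuous fun y : ℝ ↦ (n : ℂ) ^ (-(((3 / 2 : ℝ) : ℂ) + (-y) * I)) :=
      (by fun_prop : Continuous fun y : ℝ ↦ -(((3 / 2 : ℝ) : ℂ) + (-y) * I)).const_cpow (Or.inl hn0)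
    have hbdd : ∀ y : ℝ, ‖(n : ℂ) ^ (-(((3 / 2 : ℝ) : ℂ) + (-y) * I))‖ ≤ (n : ℝ) ^ (-(3 / 2 : ℝ)) := by
      intro y
      rw [norm_natCast_cpow_of_pos hn]
      simp
    have h := (hF.bdd_mul hcont.aestronglyMeasurable (ae_of_all _ hbdd)).const_mul (((Λ n : ℝ) : ℂ))
    refine h.congr (Eventually.of_forall fun y ↦ ?_)
    simp only [hFn, LSeries.term_of_ne_zero hn.ne', div_eq_mul_inv, ← cpow_neg]
    ring
  have hF_sum : Summable fun n ↦ ∫ y, ‖Fn n y‖ := by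
    have : ∀ n, ∫ y, ‖Fn n y‖ = ‖LSeries.term (fun n ↦ ((Λ n : ℝ) : ℂ)) ((3 / 2 : ℝ) : ℂ) n‖
        * ∫ y : ℝ, ‖fordLaplace₀ f (s - (((-(1 / 2) : ℝ) : ℂ) + y * I))‖ := by
      intro n
      have h' : (fun y : ℝ ↦ ‖Fn n y‖) = fun y : ℝ ↦
          ‖LSeries.term (fun n ↦ ((Λ n : ℝ) : ℂ)) ((3 / 2 : ℝ) : ℂ) n‖
            * ‖fordLaplace₀ f (s - (((-(1 / 2) : ℝ) : ℂ) + y * I))‖ := by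
        funext y
        simp only [hFn, norm_mul, norm_term_reflected]
      rw [h', integral_const_mul]
    simp_rw [this]
    exact summable_norm_term_three_halves.mul_right _
  have hterm : ∀ n, ∫ y, Fn n y = 0 := by
    intro n
    rcases Nat.eq_zero_or_pos n with rfl | hn
    · have h0 : Fn 0 = fun _ ↦ 0 := by
        funext y
        simp only [hFn, LSeries.term_zero, zero_mul]
      rw [h0, integral_zero]
    · have h := integral_term_reflected_eq_zero hfc hf1 hx₁ hs hint (Nat.one_le_of_lt hn)
      have h' : Fn n = fun y : ℝ ↦ ((Λ n : ℝ) : ℂ)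
          * ((n : ℂ) ^ (-(((3 / 2 : ℝ) : ℂ) + (-y) * I))
            * fordLaplace₀ f (s - (((-(1 / 2) : ℝ) : ℂ) + y * I))) := by
        funext y
        simp only [hFn, LSeries.term_of_ne_zero hn.ne', div_eq_mul_inv, ← cpow_neg]
        ring
      rw [h', integral_const_mul, h, mul_zero]
  calc ∫ y : ℝ, L (fun n ↦ ((Λ n : ℝ) : ℂ)) (((3 / 2 : ℝ) : ℂ) + (-y) * I) *
        fordLaplace₀ f (s - (((-(1 / 2) : ℝ) : ℂ) + y * I))
      = ∫ y, ∑' n, Fn n y := by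
        refine integral_congr_ae (ae_of_all _ fun y ↦ ?_)
        simp only [hFn, LSeries, tsum_mul_right]
    _ = ∑' n, ∫ y, Fn n y := (integral_tsum_of_summable_integral_norm hF_int hF_sum).symm
    _ = 0 := by simp [hterm]

/-- **The reflected prime side, with `ζ'/ζ`**: `∫_ℝ (ζ'/ζ)(3/2 − iy) F₀(s − (−½ + iy)) dy = 0`
(`−ζ'/ζ = Σ Λ(n) n^{−w}` on `Re w = 3/2`). [cite: Ford2002Millennium, Lemma 4.5 (proof)] -/
theorem integral_logDeriv_three_halves_mul_fordLaplace₀_eq_zero {f : ℝ → ℝ} {x₀ : ℝ}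
    (hfc : Continuous f) (hf0 : ∀ u, x₀ ≤ u → f u = 0) {s : ℂ} (hs : -(1 / 2) < s.re)
    (hint : Integrable fun y : ℝ ↦ fordLaplace₀ f ((s.re + 1 / 2 : ℝ) + y * I)) :
    ∫ y : ℝ, deriv riemannZeta (((3 / 2 : ℝ) : ℂ) + (-y) * I) / riemannZeta (((3 / 2 : ℝ) : ℂ) + (-y) * I)
      * fordLaplace₀ f (s - (((-(1 / 2) : ℝ) : ℂ) + y * I)) = 0 := by
  have h := integral_LSeries_reflected_mul_fordLaplace₀_eq_zero hfc hf0 hs hint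
  have e : ∀ y : ℝ, deriv riemannZeta (((3 / 2 : ℝ) : ℂ) + (-y) * I) /
      riemannZeta (((3 / 2 : ℝ) : ℂ) + (-y) * I) =
      -L (fun n ↦ ((Λ n : ℝ) : ℂ)) (((3 / 2 : ℝ) : ℂ) + (-y) * I) := by
    intro y
    rw [ArithmeticFunction.LSeries_vonMangoldt_eq_deriv_riemannZeta_div (by simp; norm_num)]
    ring
  have e' : (fun y : ℝ ↦ deriv riemannZeta (((3 / 2 : ℝ) : ℂ) + (-y) * I) /
      riemannZeta (((3 / 2 : ℝ) : ℂ) + (-y) * I) * fordLaplace₀ f (s - (((-(1 / 2) : ℝ) : ℂ) + y * I))) =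
      fun y : ℝ ↦ -(L (fun n ↦ ((Λ n : ℝ) : ℂ)) (((3 / 2 : ℝ) : ℂ) + (-y) * I) *
        fordLaplace₀ f (s - (((-(1 / 2) : ℝ) : ℂ) + y * I))) := by
    funext y; rw [e y]; ring
  rw [e', integral_neg, h, neg_zero]

/-! ### The `Γ`-piece `V(y) = log π − Re ψ(¾ + iy/2) + 1/(−½ + iy)` -/

set_option maxHeartbeats 800000 in
/-- **`‖log π − Re ψ(¾ + iu/2) + 1/(−½ + iu)‖ ≤ 2.57 + ½ log(1 + u²/9)`** for all real `u`: the
three ranges `|u| ≤ 2`, `2 < |u| ≤ 8`, `|u| > 8` of the tree's proof of Ford's Lemma 3.2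
(`FordL32.norm_logDeriv_zeta_left_le`) give `2.565`, `2.523` and `½ log(1 + u²/9) − 0.1`.
[cite: Ford2002Millennium, Lemma 3.2 (proof)] -/
theorem norm_gammaPiece_le (u : ℝ) :
    ‖(Real.log π : ℂ) - ((digamma (((3 / 4 : ℝ) : ℂ) + ((u / 2 : ℝ) : ℂ) * I)).re : ℂ)
        + 1 / (((-(1 / 2) : ℝ) : ℂ) + u * I)‖ ≤ 2.57 + 1 / 2 * Real.log (1 + u ^ 2 / 9) := by
  set R : ℝ := (digamma (((3 / 4 : ℝ) : ℂ) + ((u / 2 : ℝ) : ℂ) * I)).re with hR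
  set Φ : ℝ := Real.log π - R - 2 / (1 + 4 * u ^ 2) with hΦ
  set Ψ : ℝ := -4 * u / (1 + 4 * u ^ 2) with hΨ
  obtain ⟨hre1, him1⟩ := FordL32.one_div_s_re_im u
  have hV : (Real.log π : ℂ) - (R : ℂ) + 1 / (((-(1 / 2) : ℝ) : ℂ) + u * I) = (Φ : ℂ) + (Ψ : ℂ) * I := by
    rw [← re_add_im (1 / (((-(1 / 2) : ℝ) : ℂ) + u * I)), hre1, him1, hΦ, hΨ]
    push_cast; ring
  rw [hV]
  have hlog0 : 0 ≤ Real.log (1 + u ^ 2 / 9) := Real.log_nonneg (by nlinarith)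
  have hnormV : ‖(Φ : ℂ) + (Ψ : ℂ) * I‖ ^ 2 = Φ ^ 2 + Ψ ^ 2 := by
    rw [Complex.sq_norm, Complex.normSq_add_mul_I]
  have hπ1 := FordL32.log_pi_lt
  have hπ2 := FordL32.lt_log_pi
  have hden : 0 < 1 + 4 * u ^ 2 := by positivity
  have hRlow : -(4 / 3 : ℝ) ≤ R := by
    have := FordL32.re_digamma_mono (x := 3 / 4) (y₁ := 0) (y₂ := u / 2) (by norm_num)
      (by simp [abs_nonneg])
    exact FordL32.re_digamma_three_quarters_ge.trans this
  have hΨ1 : Ψ ^ 2 ≤ 1 := by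
    rw [hΨ, div_pow, div_le_one (by positivity)]
    nlinarith [sq_nonneg (u ^ 2 - 1 / 4)]
  rcases le_or_gt |u| 2 with hu2 | hu2
  · -- Case `|u| ≤ 2`
    have hRup : R ≤ 1.36 := by
      have := FordL32.re_digamma_mono (x := 3 / 4) (y₁ := u / 2) (y₂ := 1) (by norm_num)
        (by rw [abs_div, abs_two, abs_one]; linarith)
      exact this.trans FordL32.re_digamma_three_quarters_add_I_le
    have hu4 : u ^ 2 ≤ 4 := by nlinarith [abs_nonneg u, sq_abs u]
    have hfrac1 : 2 / 17 ≤ 2 / (1 + 4 * u ^ 2) :=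
      div_le_div_of_nonneg_left (by norm_num) hden (by linarith)
    have hfrac2 : 2 / (1 + 4 * u ^ 2) ≤ 2 := by
      rw [div_le_iff₀ hden]; nlinarith
    have hΦup : Φ ≤ 2.361 := by rw [hΦ]; linarith
    have hΦlo : -2.27 ≤ Φ := by rw [hΦ]; linarith
    have hV2 : ‖(Φ : ℂ) + (Ψ : ℂ) * I‖ ≤ 2.565 := by
      have h1 : ‖(Φ : ℂ) + (Ψ : ℂ) * I‖ ^ 2 ≤ 2.565 ^ 2 := by
        rw [hnormV]; nlinarith
      exact (pow_le_pow_iff_left₀ (norm_nonneg _) (by norm_num) two_ne_zero).1 h1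
    linarith
  rcases le_or_gt |u| 8 with hu8 | hu8
  · -- Case `2 < |u| ≤ 8`
    have hRup : R ≤ 1.64 := by
      have := FordL32.re_digamma_mono (x := 3 / 4) (y₁ := u / 2) (y₂ := 4) (by norm_num)
        (by rw [abs_div, abs_two, show |(4 : ℝ)| = 4 by norm_num]; linarith)
      exact this.trans FordL32.re_digamma_three_quarters_add_four_I_le
    have hu4 : 4 < u ^ 2 := by nlinarith [abs_nonneg u, sq_abs u]
    have hfrac1 : 0 ≤ 2 / (1 + 4 * u ^ 2) := by positivity
    have hfrac2 : 2 / (1 + 4 * u ^ 2) ≤ 2 / 17 :=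
      div_le_div_of_nonneg_left (by norm_num) (by norm_num) (by linarith)
    have hΦup : Φ ≤ 2.4784 := by rw [hΦ]; linarith
    have hΦlo : -0.668 ≤ Φ := by rw [hΦ]; linarith
    have hΨ2 : Ψ ^ 2 ≤ (8 / 17) ^ 2 := by
      rw [hΨ, div_pow, div_le_iff₀ (by positivity)]
      nlinarith [hu4]
    have hV2 : ‖(Φ : ℂ) + (Ψ : ℂ) * I‖ ≤ 2.523 := by
      have h1 : ‖(Φ : ℂ) + (Ψ : ℂ) * I‖ ^ 2 ≤ 2.523 ^ 2 := by
        rw [hnormV]; nlinarith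
      exact (pow_le_pow_iff_left₀ (norm_nonneg _) (by norm_num) two_ne_zero).1 h1
    linarith
  · -- Case `|u| > 8`
    obtain ⟨hL, hψL⟩ := FordL32.large_u_bounds hu8.le
    set Lz : ℝ := Real.log ‖((3 / 4 : ℝ) : ℂ) + ((u / 2 : ℝ) : ℂ) * I‖ with hLdef
    rw [abs_le] at hψL
    have hu64 : 64 < u ^ 2 := by nlinarith [abs_nonneg u, sq_abs u]
    have hfrac1 : 0 ≤ 2 / (1 + 4 * u ^ 2) := by positivity
    have hfrac2 : 2 / (1 + 4 * u ^ 2) ≤ 2 / 257 :=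
      div_le_div_of_nonneg_left (by norm_num) (by norm_num) (by linarith)
    have hΦneg : Φ ≤ 0 := by rw [hΦ]; linarith
    have hΦabs : |Φ| ≤ Lz - 0.8556 := by
      rw [abs_of_nonpos hΦneg, hΦ]; linarith
    have hΨabs : |Ψ| ≤ 1 / 8 := by
      rw [hΨ, abs_div, abs_of_pos hden, div_le_iff₀ hden, abs_mul, show |(-4 : ℝ)| = 4 by norm_num]
      nlinarith [abs_nonneg u, sq_abs u]
    have hV2 : ‖(Φ : ℂ) + (Ψ : ℂ) * I‖ ≤ |Φ| + |Ψ| := by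
      refine (norm_add_le _ _).trans ?_
      rw [norm_mul, Complex.norm_I, mul_one, Complex.norm_real, Complex.norm_real, Real.norm_eq_abs,
        Real.norm_eq_abs]
    have hLup : Lz ≤ 5 / 8 + 1 / 2 * Real.log (1 + u ^ 2 / 9) := by
      have hsq : ‖((3 / 4 : ℝ) : ℂ) + ((u / 2 : ℝ) : ℂ) * I‖ ^ 2 = 9 / 16 + u ^ 2 / 4 := by
        rw [Complex.sq_norm, Complex.normSq_add_mul_I]; ring
      have hL2 : Lz = Real.log (9 / 16 + u ^ 2 / 4) / 2 := by
        rw [hLdef, ← hsq, Real.log_pow]; push_cast; ring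
      have hle : Real.log (9 / 16 + u ^ 2 / 4) ≤ Real.log (9 / 4) + Real.log (1 + u ^ 2 / 9) := by
        rw [← Real.log_mul (by norm_num) (by positivity)]
        exact Real.log_le_log (by positivity) (by nlinarith)
      have h94 : Real.log (9 / 4 : ℝ) ≤ 5 / 4 := by
        have := Real.log_le_sub_one_of_pos (by norm_num : (0 : ℝ) < 9 / 4); linarith
      rw [hL2]; linarith
    linarith

/-! ### Lorentzian integrals -/

/-- `∫_ℝ dy/(a² + y²) = π/a` for `a > 0`. [folklore] -/
theorem integral_inv_sq_add_sq {a : ℝ} (ha : 0 < a) :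
    ∫ y : ℝ, (a ^ 2 + y ^ 2)⁻¹ = π / a := by
  have h : (fun y : ℝ ↦ (a ^ 2 + y ^ 2)⁻¹) = fun y : ℝ ↦ (a ^ 2)⁻¹ * (1 + (y / a) ^ 2)⁻¹ := by
    funext y
    rw [← mul_inv, mul_add, mul_one, div_pow, mul_div_cancel₀ _ (pow_ne_zero 2 ha.ne')]
  rw [h, integral_const_mul, Measure.integral_comp_div (fun y : ℝ ↦ (1 + y ^ 2)⁻¹) a,
    integral_univ_inv_one_add_sq, abs_of_pos ha, smul_eq_mul]
  field_simp

/-- `y ↦ (a² + y²)⁻¹` is integrable (`a > 0`). [folklore] -/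
theorem integrable_inv_sq_add_sq {a : ℝ} (ha : 0 < a) :
    Integrable fun y : ℝ ↦ (a ^ 2 + y ^ 2)⁻¹ := by
  have h : (fun y : ℝ ↦ (a ^ 2 + y ^ 2)⁻¹) = fun y : ℝ ↦ (a ^ 2)⁻¹ * (1 + (y / a) ^ 2)⁻¹ := by
    funext y
    rw [← mul_inv, mul_add, mul_one, div_pow, mul_div_cancel₀ _ (pow_ne_zero 2 ha.ne')]
  rw [h]
  exact (integrable_inv_one_add_sq.comp_div ha.ne').const_mul _

/-- `∫_ℝ dy/(a² + (t − y)²) = π/a` for `a > 0` and every real `t`. [folklore] -/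
theorem integral_inv_sq_add_sq_sub {a : ℝ} (ha : 0 < a) (t : ℝ) :
    ∫ y : ℝ, (a ^ 2 + (t - y) ^ 2)⁻¹ = π / a := by
  rw [← integral_inv_sq_add_sq ha]
  exact integral_sub_left_eq_self (fun y : ℝ ↦ (a ^ 2 + y ^ 2)⁻¹) volume t

/-- `y ↦ (a² + (t − y)²)⁻¹` is integrable. [folklore] -/
theorem integrable_inv_sq_add_sq_sub {a : ℝ} (ha : 0 < a) (t : ℝ) :
    Integrable fun y : ℝ ↦ (a ^ 2 + (t - y) ^ 2)⁻¹ :=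
  (integrable_inv_sq_add_sq ha).comp_sub_left t

/-- The tail integral `∫_U^∞ 2 log y / y² dy = 2(log U + 1)/U` (`U ≥ 1`), and its integrability.
[folklore] -/
theorem integral_two_log_div_sq_Ioi {U : ℝ} (hU : 1 ≤ U) :
    IntegrableOn (fun y : ℝ ↦ 2 * Real.log y / y ^ 2) (Ioi U) ∧
      ∫ y in Ioi U, 2 * Real.log y / y ^ 2 = 2 * (Real.log U + 1) / U := by
  -- antiderivative `g(y) = −2(log y + 1)/y`, `g → 0`
  set g : ℝ → ℝ := fun y ↦ -(2 * (Real.log y + 1) / y) with hg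
  have hderiv : ∀ y ∈ Ici U, HasDerivAt g (2 * Real.log y / y ^ 2) y := by
    intro y hy
    have hy0 : 0 < y := by linarith [mem_Ici.1 hy]
    have h1 : HasDerivAt (fun y ↦ 2 * (Real.log y + 1)) (2 * (1 / y)) y := by
      simpa using ((Real.hasDerivAt_log hy0.ne').add_const 1).const_mul 2
    refine ((h1.div (hasDerivAt_id y) hy0.ne').neg).congr_deriv ?_
    simp only [id]
    field_simp
    ring
  have hpos : ∀ y ∈ Ioi U, 0 ≤ 2 * Real.log y / y ^ 2 := by
    intro y hy
    have hy1 : 1 ≤ y := by linarith [mem_Ioi.1 hy]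
    have := Real.log_nonneg hy1
    positivity
  have hlim : Tendsto g atTop (𝓝 0) := by
    -- `(log y + 1)/y → 0`
    have h1 : Tendsto (fun y : ℝ ↦ Real.log y ^ 1 / (1 * y + 0)) atTop (𝓝 0) :=
      Real.tendsto_pow_log_div_mul_add_atTop 1 0 1 one_ne_zero
    have h2 : Tendsto (fun y : ℝ ↦ 1 / y) atTop (𝓝 0) := by
      simpa only [one_div] using tendsto_inv_atTop_zero
    have h3 : Tendsto (fun y : ℝ ↦ -(2 * (Real.log y ^ 1 / (1 * y + 0) + 1 / y))) atTop (𝓝 (-(2 * (0 + 0)))) :=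
      ((h1.add h2).const_mul 2).neg
    rw [show -(2 * ((0 : ℝ) + 0)) = 0 by norm_num] at h3
    refine h3.congr' ?_
    filter_upwards [eventually_gt_atTop (0 : ℝ)] with y hy
    simp only [hg, pow_one, one_mul, add_zero]
    field_simp
  have hint := integrableOn_Ioi_deriv_of_nonneg' hderiv hpos hlim
  refine ⟨hint, ?_⟩
  rw [integral_Ioi_of_hasDerivAt_of_tendsto' hderiv hint hlim]
  simp only [hg]
  ring

/-- **Crude bound for the logarithmic Lorentzian integral**: for `a ≥ 16/15`,
`∫_ℝ log(1 + y²/a)/(9/4 + y²) dy ≤ (2π/3) log(1 + 16/a) + (log 4 + 1)` (split at `|y| = 4`: on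
`|y| ≤ 4` the logarithm is at most `log(1 + 16/a)`, and for `|y| ≥ 4`,
`log(1 + y²/a) ≤ 2 log|y|`, `∫_4^∞ 2 log y/y² dy = (log 4 + 1)/2`), together with the integrability
of the integrand. [folklore] -/
theorem integral_log_lorentz_le {a : ℝ} (ha : 16 / 15 ≤ a) :
    Integrable (fun y : ℝ ↦ Real.log (1 + y ^ 2 / a) / (9 / 4 + y ^ 2)) ∧
    ∫ y : ℝ, Real.log (1 + y ^ 2 / a) / (9 / 4 + y ^ 2) ≤
      2 * π / 3 * Real.log (1 + 16 / a) + (Real.log 4 + 1) := by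
  have ha0 : 0 < a := by linarith
  set M : ℝ := Real.log (1 + 16 / a) with hM
  have hM0 : 0 ≤ M := Real.log_nonneg (by have := div_pos (by norm_num : (0:ℝ) < 16) ha0; linarith)
  -- the pieces of the majorant
  set k : ℝ → ℝ := fun y ↦ ((3 / 2 : ℝ) ^ 2 + y ^ 2)⁻¹ with hk
  set tail : ℝ → ℝ := (Ioi (4 : ℝ)).indicator fun y ↦ 2 * Real.log y / y ^ 2 with htail
  obtain ⟨htint, htval⟩ := integral_two_log_div_sq_Ioi (U := 4) (by norm_num)
  have hk_int : Integrable k := integrable_inv_sq_add_sq (by norm_num : (0 : ℝ) < 3 / 2)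
  have hk_val : ∫ y, k y = 2 * π / 3 := by
    simp only [hk]; rw [integral_inv_sq_add_sq (by norm_num : (0 : ℝ) < 3 / 2)]; ring
  have htail_int : Integrable tail := by
    rw [htail, integrable_indicator_iff measurableSet_Ioi]; exact htint
  have htail_val : ∫ y, tail y = (Real.log 4 + 1) / 2 := by
    rw [htail, integral_indicator measurableSet_Ioi, htval]; ring
  have htail_neg_int : Integrable fun y ↦ tail (-y) := htail_int.comp_neg
  have htail_neg_val : ∫ y, tail (-y) = (Real.log 4 + 1) / 2 := by
    rw [integral_neg_eq_self tail volume, htail_val]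
  have htail_nn : ∀ y, 0 ≤ tail y := by
    intro y
    simp only [htail]
    refine Set.indicator_nonneg (fun y hy ↦ ?_) y
    have hy1 : 1 ≤ y := by linarith [mem_Ioi.1 hy]
    have := Real.log_nonneg hy1
    positivity
  -- pointwise bound
  have hpt : ∀ y : ℝ, Real.log (1 + y ^ 2 / a) / (9 / 4 + y ^ 2) ≤ M * k y + tail y + tail (-y) := by
    intro y
    have hden : 0 < 9 / 4 + y ^ 2 := by positivity
    have hk_eq : k y = (9 / 4 + y ^ 2)⁻¹ := by simp only [hk]; norm_num
    have hlog_nn : 0 ≤ Real.log (1 + y ^ 2 / a) := Real.log_nonneg (le_add_of_nonneg_right (by positivity))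
    rcases le_or_gt |y| 4 with hy | hy
    · -- middle
      have hy16 : y ^ 2 ≤ 16 := by nlinarith [abs_nonneg y, sq_abs y]
      have hlogM : Real.log (1 + y ^ 2 / a) ≤ M := by
        rw [hM]; refine Real.log_le_log (by positivity) ?_
        have : y ^ 2 / a ≤ 16 / a := div_le_div_of_nonneg_right hy16 ha0.le
        linarith
      calc Real.log (1 + y ^ 2 / a) / (9 / 4 + y ^ 2) ≤ M / (9 / 4 + y ^ 2) :=
            div_le_div_of_nonneg_right hlogM hden.le
        _ = M * k y := by rw [hk_eq, div_eq_mul_inv]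
        _ ≤ M * k y + tail y + tail (-y) := by linarith [htail_nn y, htail_nn (-y)]
    · -- tails: `log(1 + y²/a) ≤ 2 log|y|` and `1/(9/4 + y²) ≤ 1/y²`
      have hy0 : 0 < |y| := by linarith
      have hysq : 16 < y ^ 2 := by nlinarith [abs_nonneg y, sq_abs y]
      have hlog2 : Real.log (1 + y ^ 2 / a) ≤ 2 * Real.log |y| := by
        have e : 2 * Real.log |y| = Real.log (|y| ^ 2) := by
          rw [Real.log_pow]; norm_num
        rw [e, sq_abs]
        refine Real.log_le_log (by positivity) ?_
        -- `1 + y²/a ≤ y²` since `a ≥ 16/15` and `y² > 16`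
        rw [← sub_nonneg]
        have : y ^ 2 / a ≤ y ^ 2 * (15 / 16) := by
          rw [div_le_iff₀ ha0]; nlinarith
        nlinarith
      have hmain : Real.log (1 + y ^ 2 / a) / (9 / 4 + y ^ 2) ≤ 2 * Real.log |y| / |y| ^ 2 := by
        rw [sq_abs]
        calc Real.log (1 + y ^ 2 / a) / (9 / 4 + y ^ 2) ≤ 2 * Real.log |y| / (9 / 4 + y ^ 2) :=
              div_le_div_of_nonneg_right hlog2 hden.le
          _ ≤ 2 * Real.log |y| / y ^ 2 := by
              apply div_le_div_of_nonneg_left _ (by positivity) (by linarith)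
              have := Real.log_nonneg (by linarith : (1 : ℝ) ≤ |y|); positivity
      have hMk : 0 ≤ M * k y := mul_nonneg hM0 (by rw [hk_eq]; positivity)
      rcases le_or_gt 0 y with hy' | hy'
      · have hyy : |y| = y := abs_of_nonneg hy'
        have ht : tail y = 2 * Real.log y / y ^ 2 := by
          simp only [htail]; rw [Set.indicator_of_mem (by rw [mem_Ioi, ← hyy]; exact hy)]
        rw [hyy] at hmain
        linarith [htail_nn (-y)]
      · have hyy : |y| = -y := abs_of_neg hy'
        have ht : tail (-y) = 2 * Real.log (-y) / (-y) ^ 2 := by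
          simp only [htail]; rw [Set.indicator_of_mem (by rw [mem_Ioi, ← hyy]; exact hy)]
        rw [hyy] at hmain
        linarith [htail_nn y]
  -- integrability of the left side: continuous and dominated
  have hcont : Continuous fun y : ℝ ↦ Real.log (1 + y ^ 2 / a) / (9 / 4 + y ^ 2) := by
    refine Continuous.div ?_ (by fun_prop) fun y ↦ (by positivity : (9 / 4 + y ^ 2 : ℝ) ≠ 0)
    exact (by fun_prop : Continuous fun y : ℝ ↦ 1 + y ^ 2 / a).log fun y ↦
      (by positivity : (1 + y ^ 2 / a : ℝ) ≠ 0)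
  have hmaj_int : Integrable fun y ↦ M * k y + tail y + tail (-y) :=
    ((hk_int.const_mul M).add htail_int).add htail_neg_int
  have hnn : ∀ y, 0 ≤ Real.log (1 + y ^ 2 / a) / (9 / 4 + y ^ 2) := fun y ↦
    div_nonneg (Real.log_nonneg (le_add_of_nonneg_right (by positivity))) (by positivity)
  have hint : Integrable fun y : ℝ ↦ Real.log (1 + y ^ 2 / a) / (9 / 4 + y ^ 2) := by
    refine hmaj_int.mono' hcont.aestronglyMeasurable (ae_of_all _ fun y ↦ ?_)
    rw [Real.norm_eq_abs, abs_of_nonneg (hnn y)]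
    exact hpt y
  refine ⟨hint, ?_⟩
  calc ∫ y : ℝ, Real.log (1 + y ^ 2 / a) / (9 / 4 + y ^ 2)
      ≤ ∫ y, (M * k y + tail y + tail (-y)) := integral_mono hint hmaj_int hpt
    _ = M * (2 * π / 3) + (Real.log 4 + 1) / 2 + (Real.log 4 + 1) / 2 := by
        have hI1 : Integrable (fun y ↦ M * k y + tail y) := (hk_int.const_mul M).add htail_int
        rw [integral_add hI1 htail_neg_int, integral_add (hk_int.const_mul M) htail_int,
          integral_const_mul, hk_val, htail_val, htail_neg_val]
    _ = 2 * π / 3 * Real.log (1 + 16 / a) + (Real.log 4 + 1) := by rw [hM]; ring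

/-! ### The remainder bound -/

section remainder

variable {f p p' p'' : ℝ → ℝ} {x₀ D : ℝ}

/-- The integrand of the remainder splits as `G(w) = (T(y) − V(y)) F₀(s − w)`, `w = −½ + iy`,
`T(y) = ζ'/ζ(3/2 − iy)`, `V(y) = log π − Re ψ(¾ + iy/2) + 1/w`. [cite: Ford2002Millennium, Lemma 3.2 (proof)] -/
theorem smoothedEFIntegrand_left_eq (f : ℝ → ℝ) (s : ℂ) (y : ℝ) :
    smoothedEFIntegrand f s (((-(1 / 2) : ℝ) : ℂ) + y * I) =
      deriv riemannZeta (((3 / 2 : ℝ) : ℂ) + (-y) * I) / riemannZeta (((3 / 2 : ℝ) : ℂ) + (-y) * I)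
        * fordLaplace₀ f (s - (((-(1 / 2) : ℝ) : ℂ) + y * I))
      - ((Real.log π : ℂ) - ((digamma (((3 / 4 : ℝ) : ℂ) + ((y / 2 : ℝ) : ℂ) * I)).re : ℂ)
          + 1 / (((-(1 / 2) : ℝ) : ℂ) + y * I)) * fordLaplace₀ f (s - (((-(1 / 2) : ℝ) : ℂ) + y * I)) := by
  rw [smoothedEFIntegrand, FordL32.logDeriv_zeta_left_eq y]
  ring

/-- **The remainder as an integral of the `Γ`-piece alone**: for an admissible smoothing and
`Re s > −½`, `2π · E = −∫ V(y) F₀(s − (−½ + iy)) dy`. [cite: Ford2002Millennium, Lemma 4.5 (proof, (4.8))] -/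
theorem smoothedEFRemainder_eq (h : IsSmoothedEFTest f p p' p'' x₀) {s : ℂ} (hs : -(1 / 2) < s.re) :
    smoothedEFRemainder f s = -((1 / (2 * π) : ℂ) * ∫ y : ℝ,
      ((Real.log π : ℂ) - ((digamma (((3 / 4 : ℝ) : ℂ) + ((y / 2 : ℝ) : ℂ) * I)).re : ℂ)
          + 1 / (((-(1 / 2) : ℝ) : ℂ) + y * I)) * fordLaplace₀ f (s - (((-(1 / 2) : ℝ) : ℂ) + y * I))) := by
  have hint : Integrable fun y : ℝ ↦ fordLaplace₀ f ((s.re + 1 / 2 : ℝ) + y * I) :=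
    SmoothedEF.integrable_vertical h (ne_of_gt (by linarith : (0 : ℝ) < s.re + 1 / 2))
  have hF := integrable_fordLaplace₀_reflected hint
  -- integrability of the `T`-part
  have hT : Integrable fun y : ℝ ↦ deriv riemannZeta (((3 / 2 : ℝ) : ℂ) + (-y) * I) /
      riemannZeta (((3 / 2 : ℝ) : ℂ) + (-y) * I) * fordLaplace₀ f (s - (((-(1 / 2) : ℝ) : ℂ) + y * I)) := by
    have hc : Continuous fun y : ℝ ↦ deriv riemannZeta (((3 / 2 : ℝ) : ℂ) + (-y) * I) /
        riemannZeta (((3 / 2 : ℝ) : ℂ) + (-y) * I) := by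
      have e : (fun y : ℝ ↦ deriv riemannZeta (((3 / 2 : ℝ) : ℂ) + (-y) * I) /
          riemannZeta (((3 / 2 : ℝ) : ℂ) + (-y) * I)) =
          fun y : ℝ ↦ -L (fun n ↦ ((Λ n : ℝ) : ℂ)) (((3 / 2 : ℝ) : ℂ) + (-y) * I) := by
        funext y
        rw [ArithmeticFunction.LSeries_vonMangoldt_eq_deriv_riemannZeta_div (by simp; norm_num)]
        ring
      rw [e]; exact continuous_LSeries_reflected.neg
    have hbd : ∀ y : ℝ, ‖deriv riemannZeta (((3 / 2 : ℝ) : ℂ) + (-y) * I) /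
        riemannZeta (((3 / 2 : ℝ) : ℂ) + (-y) * I)‖ ≤ 2 := by
      intro y
      have hlt := norm_deriv_riemannZeta_div_lt (s := ((3 / 2 : ℝ) : ℂ) + (-y) * I) (by simp; norm_num)
      have e : (((3 / 2 : ℝ) : ℂ) + (-y) * I).re - 1 = 1 / 2 := by simp; norm_num
      rw [e] at hlt
      linarith
    exact hF.bdd_mul hc.aestronglyMeasurable (ae_of_all _ hbd)
  have hG := SmoothedEF.integrable_integrand_left h hs
  have hVF : Integrable fun y : ℝ ↦ ((Real.log π : ℂ) -
      ((digamma (((3 / 4 : ℝ) : ℂ) + ((y / 2 : ℝ) : ℂ) * I)).re : ℂ) + 1 / (((-(1 / 2) : ℝ) : ℂ) + y * I))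
        * fordLaplace₀ f (s - (((-(1 / 2) : ℝ) : ℂ) + y * I)) := by
    refine (hT.sub hG).congr (ae_of_all _ fun y ↦ ?_)
    simp only [Pi.sub_apply, smoothedEFIntegrand_left_eq]
    ring
  unfold smoothedEFRemainder
  have e : ∫ y : ℝ, smoothedEFIntegrand f s (((-(1 / 2) : ℝ) : ℂ) + y * I) =
      (∫ y : ℝ, deriv riemannZeta (((3 / 2 : ℝ) : ℂ) + (-y) * I) /
          riemannZeta (((3 / 2 : ℝ) : ℂ) + (-y) * I) * fordLaplace₀ f (s - (((-(1 / 2) : ℝ) : ℂ) + y * I)))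
      - ∫ y : ℝ, ((Real.log π : ℂ) - ((digamma (((3 / 4 : ℝ) : ℂ) + ((y / 2 : ℝ) : ℂ) * I)).re : ℂ)
          + 1 / (((-(1 / 2) : ℝ) : ℂ) + y * I)) * fordLaplace₀ f (s - (((-(1 / 2) : ℝ) : ℂ) + y * I)) := by
    rw [← integral_sub hT hVF]
    refine integral_congr_ae (ae_of_all _ fun y ↦ ?_)
    exact smoothedEFIntegrand_left_eq f s y
  rw [e, integral_logDeriv_three_halves_mul_fordLaplace₀_eq_zero h.cont h.eq_zero hs hint, zero_sub]
  ring

/-- **The remainder is bounded by a Lorentzian average of `2.57 + ½ log(1 + y²/9)`**: for `Re s ≥ 1`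
and `D` with `‖F₀(z)‖ ≤ D/‖z‖²` on `Re z ≥ 3/2`,
`‖E‖ ≤ (D/2π) ∫ (2.57 + ½ log(1 + y²/9)) / ((Re s + ½)² + (Im s − y)²) dy`.
[cite: Ford2002Millennium, Lemma 4.5 (proof)] -/
theorem norm_smoothedEFRemainder_le_integral (h : IsSmoothedEFTest f p p' p'' x₀) {s : ℂ}
    (hs : 1 ≤ s.re) (hD : ∀ z : ℂ, 3 / 2 ≤ z.re → ‖fordLaplace₀ f z‖ ≤ D / ‖z‖ ^ 2) :
    ‖smoothedEFRemainder f s‖ ≤ D / (2 * π) *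
      ∫ y : ℝ, (2.57 + 1 / 2 * Real.log (1 + y ^ 2 / 9)) * ((s.re + 1 / 2) ^ 2 + (s.im - y) ^ 2)⁻¹ := by
  have hs' : -(1 / 2) < s.re := by linarith
  rw [smoothedEFRemainder_eq h hs', norm_neg, norm_mul]
  have h2π : ‖(1 / (2 * π) : ℂ)‖ = 1 / (2 * π) := by
    rw [show (1 / (2 * π) : ℂ) = ((1 / (2 * π) : ℝ) : ℂ) by push_cast; ring, Complex.norm_real,
      Real.norm_eq_abs, abs_of_pos (by positivity)]
  rw [h2π]
  set a : ℝ := s.re + 1 / 2 with ha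
  have ha0 : 0 < a := by rw [ha]; linarith
  -- the majorant is integrable
  have hmaj : Integrable fun y : ℝ ↦ (2.57 + 1 / 2 * Real.log (1 + y ^ 2 / 9)) * (a ^ 2 + (s.im - y) ^ 2)⁻¹ := by
    -- `≤ (2.57 + ½ log(1 + 2 Im² /9)) k + ½ log(1 + 2(y − Im s)²/9) k`, all integrable; simpler: dominate
    -- by `(2.57 + ½·2·log(1+|y|)) / (a² + (Im s − y)²)` via `SmoothedEF.integrable_left_majorant'`
    have hm := SmoothedEF.integrable_left_majorant' (A := 2.57) (a := a) (t := s.im) (by norm_num) ha0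
    refine hm.mono' ?_ (ae_of_all _ fun y ↦ ?_)
    · refine ((Continuous.mul ?_ ?_)).aestronglyMeasurable
      · exact continuous_const.add (continuous_const.mul ((by fun_prop : Continuous fun y : ℝ ↦ 1 + y ^ 2 / 9).log
          fun y ↦ (by positivity : (1 + y ^ 2 / 9 : ℝ) ≠ 0)))
      · exact Continuous.inv₀ (by fun_prop) fun y ↦ (by positivity : (a ^ 2 + (s.im - y) ^ 2 : ℝ) ≠ 0)
    · have hlog_nn : 0 ≤ Real.log (1 + y ^ 2 / 9) := Real.log_nonneg (le_add_of_nonneg_right (by positivity))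
      have hden : 0 < a ^ 2 + (s.im - y) ^ 2 := by positivity
      rw [Real.norm_eq_abs, abs_of_nonneg (by positivity)]
      have hll : Real.log (1 + y ^ 2 / 9) ≤ 2 * Real.log (1 + |y|) := by
        have e : 2 * Real.log (1 + |y|) = Real.log ((1 + |y|) ^ 2) := by
          rw [Real.log_pow]; norm_num
        rw [e]
        refine Real.log_le_log (by positivity) ?_
        nlinarith [abs_nonneg y, sq_abs y]
      rw [div_eq_mul_inv]
      refine mul_le_mul_of_nonneg_right ?_ (by positivity)
      linarith
  -- pointwise bound of the integrand, then integrate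
  have hbound : ‖∫ y : ℝ, ((Real.log π : ℂ) - ((digamma (((3 / 4 : ℝ) : ℂ) + ((y / 2 : ℝ) : ℂ) * I)).re : ℂ)
      + 1 / (((-(1 / 2) : ℝ) : ℂ) + y * I)) * fordLaplace₀ f (s - (((-(1 / 2) : ℝ) : ℂ) + y * I))‖ ≤
      D * ∫ y : ℝ, (2.57 + 1 / 2 * Real.log (1 + y ^ 2 / 9)) * (a ^ 2 + (s.im - y) ^ 2)⁻¹ := by
    refine (norm_integral_le_integral_norm _).trans ?_
    rw [← integral_const_mul]
    refine integral_mono_of_nonneg (ae_of_all _ fun y ↦ norm_nonneg _) (hmaj.const_mul _)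
      (ae_of_all _ fun y ↦ ?_)
    dsimp only
    rw [norm_mul]
    set w : ℂ := s - (((-(1 / 2) : ℝ) : ℂ) + y * I) with hw
    have hwre : w.re = a := by simp [hw, ha]
    have hwim : w.im = s.im - y := by simp [hw]
    have hw32 : 3 / 2 ≤ w.re := by rw [hwre, ha]; linarith
    have hnorm : ‖w‖ ^ 2 = a ^ 2 + (s.im - y) ^ 2 := by
      rw [Complex.sq_norm, Complex.normSq_apply, hwre, hwim]; ring
    have hFb : ‖fordLaplace₀ f w‖ ≤ D * (a ^ 2 + (s.im - y) ^ 2)⁻¹ := by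
      rw [← hnorm, ← div_eq_mul_inv]; exact hD w hw32
    have hV := norm_gammaPiece_le y
    have hlog_nn : 0 ≤ Real.log (1 + y ^ 2 / 9) := Real.log_nonneg (le_add_of_nonneg_right (by positivity))
    calc ‖(Real.log π : ℂ) - ((digamma (((3 / 4 : ℝ) : ℂ) + ((y / 2 : ℝ) : ℂ) * I)).re : ℂ)
            + 1 / (((-(1 / 2) : ℝ) : ℂ) + y * I)‖ * ‖fordLaplace₀ f w‖
        ≤ (2.57 + 1 / 2 * Real.log (1 + y ^ 2 / 9)) * (D * (a ^ 2 + (s.im - y) ^ 2)⁻¹) :=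
          mul_le_mul hV hFb (norm_nonneg _) (by positivity)
      _ = D * ((2.57 + 1 / 2 * Real.log (1 + y ^ 2 / 9)) * (a ^ 2 + (s.im - y) ^ 2)⁻¹) := by ring
  have h2π0 : 0 ≤ 1 / (2 * π) := by positivity
  calc 1 / (2 * π) * ‖∫ y : ℝ, ((Real.log π : ℂ) - ((digamma (((3 / 4 : ℝ) : ℂ) + ((y / 2 : ℝ) : ℂ) * I)).re : ℂ)
        + 1 / (((-(1 / 2) : ℝ) : ℂ) + y * I)) * fordLaplace₀ f (s - (((-(1 / 2) : ℝ) : ℂ) + y * I))‖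
      ≤ 1 / (2 * π) * (D * ∫ y : ℝ, (2.57 + 1 / 2 * Real.log (1 + y ^ 2 / 9)) * (a ^ 2 + (s.im - y) ^ 2)⁻¹) :=
        mul_le_mul_of_nonneg_left hbound h2π0
    _ = _ := by rw [ha]; ring

/-! ### The two consumable forms -/

/-- `log(1 + y²/9) ≤ log(1 + 2t²/9) + log(1 + (t − y)²/(9/2))` (`y² ≤ 2t² + 2(t − y)²`). [folklore] -/
theorem log_one_add_sq_le_shift (t y : ℝ) :
    Real.log (1 + y ^ 2 / 9) ≤ Real.log (1 + 2 * t ^ 2 / 9) + Real.log (1 + (t - y) ^ 2 / (9 / 2)) := by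
  rw [← Real.log_mul (by positivity) (by positivity)]
  refine Real.log_le_log (by positivity) ?_
  nlinarith [sq_nonneg (2 * t - y), mul_nonneg (sq_nonneg t) (sq_nonneg (t - y))]

/-- **The shifted logarithmic Lorentzian integral**:
`∫ log(1 + y²/9)/((3/2)² + (t − y)²) dy ≤ (2π/3) log(1 + 2t²/9) + [(2π/3) log(1 + 32/9) + log 4 + 1]`,
with integrability. [folklore] -/
theorem integral_log_lorentz_shift_le (t : ℝ) :
    Integrable (fun y : ℝ ↦ Real.log (1 + y ^ 2 / 9) * ((3 / 2 : ℝ) ^ 2 + (t - y) ^ 2)⁻¹) ∧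
    ∫ y : ℝ, Real.log (1 + y ^ 2 / 9) * ((3 / 2 : ℝ) ^ 2 + (t - y) ^ 2)⁻¹ ≤
      2 * π / 3 * Real.log (1 + 2 * t ^ 2 / 9) +
        (2 * π / 3 * Real.log (1 + 16 / (9 / 2)) + (Real.log 4 + 1)) := by
  obtain ⟨hJint, hJle⟩ := integral_log_lorentz_le (a := 9 / 2) (by norm_num)
  set k : ℝ → ℝ := fun y ↦ ((3 / 2 : ℝ) ^ 2 + (t - y) ^ 2)⁻¹ with hk
  have hk_int : Integrable k := integrable_inv_sq_add_sq_sub (by norm_num) t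
  have hk_val : ∫ y, k y = 2 * π / 3 := by
    simp only [hk]; rw [integral_inv_sq_add_sq_sub (by norm_num : (0 : ℝ) < 3 / 2)]; ring
  set φ : ℝ → ℝ := fun v ↦ Real.log (1 + v ^ 2 / (9 / 2)) / (9 / 4 + v ^ 2) with hφ
  have hφ_int : Integrable fun y ↦ φ (t - y) := hJint.comp_sub_left t
  have hφ_val : ∫ y, φ (t - y) = ∫ v, φ v := integral_sub_left_eq_self φ volume t
  have hmaj_int : Integrable fun y ↦ Real.log (1 + 2 * t ^ 2 / 9) * k y + φ (t - y) :=
    (hk_int.const_mul _).add hφ_int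
  have hpt : ∀ y, Real.log (1 + y ^ 2 / 9) * k y ≤ Real.log (1 + 2 * t ^ 2 / 9) * k y + φ (t - y) := by
    intro y
    have hk0 : 0 ≤ k y := by simp only [hk]; positivity
    have hk_eq : φ (t - y) = Real.log (1 + (t - y) ^ 2 / (9 / 2)) * k y := by
      simp only [hφ, hk]; rw [div_eq_mul_inv]; norm_num
    rw [hk_eq, ← add_mul]
    exact mul_le_mul_of_nonneg_right (log_one_add_sq_le_shift t y) hk0
  have hnn : ∀ y, 0 ≤ Real.log (1 + y ^ 2 / 9) * k y := fun y ↦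
    mul_nonneg (Real.log_nonneg (le_add_of_nonneg_right (by positivity))) (by simp only [hk]; positivity)
  have hcont : Continuous fun y : ℝ ↦ Real.log (1 + y ^ 2 / 9) * k y := by
    simp only [hk]
    refine Continuous.mul ((by fun_prop : Continuous fun y : ℝ ↦ 1 + y ^ 2 / 9).log fun y ↦ ?_)
      (Continuous.inv₀ (by fun_prop) fun y ↦ ?_)
    · positivity
    · positivity
  have hint : Integrable fun y : ℝ ↦ Real.log (1 + y ^ 2 / 9) * k y :=
    hmaj_int.mono' hcont.aestronglyMeasurable (ae_of_all _ fun y ↦ by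
      rw [Real.norm_eq_abs, abs_of_nonneg (hnn y)]; exact hpt y)
  refine ⟨hint, ?_⟩
  have hJle' : ∫ v, φ v ≤ 2 * π / 3 * Real.log (1 + 16 / (9 / 2)) + (Real.log 4 + 1) := by
    simp only [hφ]; exact hJle
  calc ∫ y, Real.log (1 + y ^ 2 / 9) * k y
      ≤ ∫ y, (Real.log (1 + 2 * t ^ 2 / 9) * k y + φ (t - y)) := integral_mono hint hmaj_int hpt
    _ = Real.log (1 + 2 * t ^ 2 / 9) * (2 * π / 3) + ∫ v, φ v := by
        rw [integral_add (hk_int.const_mul _) hφ_int, integral_const_mul, hk_val, hφ_val]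
    _ ≤ _ := by linarith

/-- **Ford's `E`-bound at `s = 1 + it`** (sharpened): for an admissible smoothing `f`, `D ≥ 0` with
`‖F₀(z)‖ ≤ D/‖z‖²` on `Re z ≥ 3/2`, and `t ≥ 6`,
`‖(1/2πi)∫_{(−1/2)} (−ζ'/ζ)(w) F₀(1 + it − w) dw‖ ≤ D (1.17 + ⅓ log t)`
(Ford: `D(1.72 + ⅓ log(1 + t))`). [cite: Ford2002Millennium, Lemma 4.5] -/
theorem norm_smoothedEFRemainder_one_add_le (h : IsSmoothedEFTest f p p' p'' x₀) (hD0 : 0 ≤ D)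
    (hD : ∀ z : ℂ, 3 / 2 ≤ z.re → ‖fordLaplace₀ f z‖ ≤ D / ‖z‖ ^ 2) {t : ℝ} (ht : 6 ≤ t) :
    ‖smoothedEFRemainder f (1 + t * I)‖ ≤ D * (1.17 + Real.log t / 3) := by
  have h0 := norm_smoothedEFRemainder_le_integral h (s := 1 + t * I) (by simp) hD
  have hre : (1 + t * I : ℂ).re = 1 := by simp
  have him : (1 + t * I : ℂ).im = t := by simp
  rw [hre, him] at h0
  have e : ∀ y : ℝ, ((1 : ℝ) + 1 / 2) ^ 2 + (t - y) ^ 2 = (3 / 2 : ℝ) ^ 2 + (t - y) ^ 2 := fun y ↦ by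
    norm_num
  simp only [e] at h0
  obtain ⟨hLint, hLle⟩ := integral_log_lorentz_shift_le t
  have hk_int : Integrable fun y : ℝ ↦ ((3 / 2 : ℝ) ^ 2 + (t - y) ^ 2)⁻¹ :=
    integrable_inv_sq_add_sq_sub (by norm_num) t
  have hk_val : ∫ y : ℝ, ((3 / 2 : ℝ) ^ 2 + (t - y) ^ 2)⁻¹ = 2 * π / 3 := by
    rw [integral_inv_sq_add_sq_sub (by norm_num : (0 : ℝ) < 3 / 2)]; ring
  have hsplit : ∫ y : ℝ, (2.57 + 1 / 2 * Real.log (1 + y ^ 2 / 9)) * ((3 / 2 : ℝ) ^ 2 + (t - y) ^ 2)⁻¹ =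
      2.57 * (2 * π / 3) + 1 / 2 * ∫ y : ℝ, Real.log (1 + y ^ 2 / 9) * ((3 / 2 : ℝ) ^ 2 + (t - y) ^ 2)⁻¹ := by
    have e2 : (fun y : ℝ ↦ (2.57 + 1 / 2 * Real.log (1 + y ^ 2 / 9)) * ((3 / 2 : ℝ) ^ 2 + (t - y) ^ 2)⁻¹) =
        fun y : ℝ ↦ 2.57 * ((3 / 2 : ℝ) ^ 2 + (t - y) ^ 2)⁻¹ +
          1 / 2 * (Real.log (1 + y ^ 2 / 9) * ((3 / 2 : ℝ) ^ 2 + (t - y) ^ 2)⁻¹) := by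
      funext y; ring
    rw [e2, integral_add (hk_int.const_mul _) (hLint.const_mul _), integral_const_mul,
      integral_const_mul, hk_val]
  rw [hsplit] at h0
  -- numerics
  have hπ := Real.pi_gt_d6
  have hπ' := Real.pi_pos
  have hl2 := Real.log_two_lt_d9
  have hl2' := Real.log_two_gt_d9
  have ht0 : 0 < t := by linarith
  have hlog4 : Real.log 4 = 2 * Real.log 2 := by
    rw [show (4 : ℝ) = 2 ^ 2 by norm_num, Real.log_pow]; norm_num
  have hlog41 : Real.log (1 + 16 / (9 / 2)) ≤ 3 * Real.log 2 := by
    rw [show (3 : ℝ) * Real.log 2 = Real.log (2 ^ 3) by rw [Real.log_pow]; norm_num]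
    exact Real.log_le_log (by norm_num) (by norm_num)
  -- `log(1 + 2t²/9) ≤ 2 log t − 2 log 2` for `t ≥ 6`
  have hlogt : Real.log (1 + 2 * t ^ 2 / 9) ≤ 2 * Real.log t - 2 * Real.log 2 := by
    have e3 : 1 + 2 * t ^ 2 / 9 = t ^ 2 * (1 / t ^ 2 + 2 / 9) := by
      field_simp
    have h36 : 1 / t ^ 2 ≤ 1 / 36 := by
      rw [div_le_div_iff₀ (by positivity) (by norm_num)]; nlinarith
    rw [e3, Real.log_mul (by positivity) (by positivity), Real.log_pow]
    have h4 : Real.log (1 / t ^ 2 + 2 / 9) ≤ Real.log (1 / 4) :=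
      Real.log_le_log (by positivity) (by linarith)
    have h14 : Real.log (1 / 4 : ℝ) = -(2 * Real.log 2) := by
      rw [one_div, Real.log_inv, hlog4]
    push_cast
    linarith
  have hfrac : (Real.log 4 + 1) / (4 * π) ≤ (2 * 0.6931471808 + 1) / (4 * 3.141592) := by
    rw [hlog4]
    exact div_le_div₀ (by norm_num) (by linarith) (by norm_num) (by linarith)
  -- assemble: `‖E‖ ≤ D/(2π) · (2.57·2π/3 + ½·I) ≤ D (1.17 + log t/3)`
  have hI : 1 / 2 * ∫ y : ℝ, Real.log (1 + y ^ 2 / 9) * ((3 / 2 : ℝ) ^ 2 + (t - y) ^ 2)⁻¹ ≤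
      1 / 2 * (2 * π / 3 * (2 * Real.log t - 2 * Real.log 2) + (2 * π / 3 * (3 * Real.log 2) + (Real.log 4 + 1))) := by
    refine mul_le_mul_of_nonneg_left (hLle.trans ?_) (by norm_num)
    gcongr
  refine h0.trans ?_
  have hkey : D / (2 * π) * (2.57 * (2 * π / 3) +
      1 / 2 * (2 * π / 3 * (2 * Real.log t - 2 * Real.log 2) + (2 * π / 3 * (3 * Real.log 2) + (Real.log 4 + 1)))) ≤
      D * (1.17 + Real.log t / 3) := by
    have e4 : D / (2 * π) * (2.57 * (2 * π / 3) +
        1 / 2 * (2 * π / 3 * (2 * Real.log t - 2 * Real.log 2) + (2 * π / 3 * (3 * Real.log 2) + (Real.log 4 + 1)))) =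
        D * (2.57 / 3 + Real.log t / 3 - Real.log 2 / 3 + Real.log 2 / 2 + (Real.log 4 + 1) / (4 * π)) := by
      field_simp
      ring
    rw [e4]
    refine mul_le_mul_of_nonneg_left ?_ hD0
    norm_num at hfrac ⊢
    linarith
  refine le_trans ?_ hkey
  refine mul_le_mul_of_nonneg_left ?_ (by positivity)
  linarith

/-- **Ford's `E`-bound at real `s = σ ≥ 1`** (sharpened): for an admissible smoothing `f`, `D ≥ 0`
with `‖F₀(z)‖ ≤ D/‖z‖²` on `Re z ≥ 3/2`, and `σ ≥ 1`,
`‖(1/2πi)∫_{(−1/2)} (−ζ'/ζ)(w) F₀(σ − w) dw‖ ≤ 1.28 D` (Ford: `1.72 D`).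
[cite: Ford2002Millennium, Lemma 4.5 and proof of Lemma 4.6] -/
theorem norm_smoothedEFRemainder_real_le (h : IsSmoothedEFTest f p p' p'' x₀) (hD0 : 0 ≤ D)
    (hD : ∀ z : ℂ, 3 / 2 ≤ z.re → ‖fordLaplace₀ f z‖ ≤ D / ‖z‖ ^ 2) {σ : ℝ} (hσ : 1 ≤ σ) :
    ‖smoothedEFRemainder f σ‖ ≤ 1.28 * D := by
  have h0 := norm_smoothedEFRemainder_le_integral h (s := (σ : ℂ)) (by simpa using hσ) hD
  simp only [ofReal_re, ofReal_im, zero_sub, even_two.neg_pow] at h0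
  set a : ℝ := σ + 1 / 2 with ha
  have ha32 : 3 / 2 ≤ a := by rw [ha]; linarith
  obtain ⟨hJint, hJle⟩ := integral_log_lorentz_le (a := 9) (by norm_num)
  have hk_int : Integrable fun y : ℝ ↦ ((3 / 2 : ℝ) ^ 2 + y ^ 2)⁻¹ := integrable_inv_sq_add_sq (by norm_num)
  have hk_val : ∫ y : ℝ, ((3 / 2 : ℝ) ^ 2 + y ^ 2)⁻¹ = 2 * π / 3 := by
    rw [integral_inv_sq_add_sq (by norm_num : (0 : ℝ) < 3 / 2)]; ring
  -- the majorant with `a` replaced by `3/2`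
  have hJ' : Integrable fun y : ℝ ↦ Real.log (1 + y ^ 2 / 9) * ((3 / 2 : ℝ) ^ 2 + y ^ 2)⁻¹ := by
    refine hJint.congr (ae_of_all _ fun y ↦ ?_)
    norm_num
    ring
  have hJ'val : ∫ y : ℝ, Real.log (1 + y ^ 2 / 9) * ((3 / 2 : ℝ) ^ 2 + y ^ 2)⁻¹ ≤
      2 * π / 3 * Real.log (1 + 16 / 9) + (Real.log 4 + 1) := by
    refine le_trans (le_of_eq ?_) hJle
    refine integral_congr_ae (ae_of_all _ fun y ↦ ?_)
    norm_num
    ring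
  have hmaj : Integrable fun y : ℝ ↦ (2.57 + 1 / 2 * Real.log (1 + y ^ 2 / 9)) * ((3 / 2 : ℝ) ^ 2 + y ^ 2)⁻¹ := by
    have e2 : (fun y : ℝ ↦ (2.57 + 1 / 2 * Real.log (1 + y ^ 2 / 9)) * ((3 / 2 : ℝ) ^ 2 + y ^ 2)⁻¹) =
        fun y : ℝ ↦ 2.57 * ((3 / 2 : ℝ) ^ 2 + y ^ 2)⁻¹ +
          1 / 2 * (Real.log (1 + y ^ 2 / 9) * ((3 / 2 : ℝ) ^ 2 + y ^ 2)⁻¹) := by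
      funext y; ring
    rw [e2]; exact (hk_int.const_mul _).add (hJ'.const_mul _)
  have hmono : ∫ y : ℝ, (2.57 + 1 / 2 * Real.log (1 + y ^ 2 / 9)) * (a ^ 2 + y ^ 2)⁻¹ ≤
      ∫ y : ℝ, (2.57 + 1 / 2 * Real.log (1 + y ^ 2 / 9)) * ((3 / 2 : ℝ) ^ 2 + y ^ 2)⁻¹ := by
    refine integral_mono_of_nonneg (ae_of_all _ fun y ↦ ?_) hmaj (ae_of_all _ fun y ↦ ?_)
    · have : 0 ≤ Real.log (1 + y ^ 2 / 9) := Real.log_nonneg (le_add_of_nonneg_right (by positivity))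
      positivity
    · have hlog : 0 ≤ Real.log (1 + y ^ 2 / 9) := Real.log_nonneg (le_add_of_nonneg_right (by positivity))
      refine mul_le_mul_of_nonneg_left ?_ (by positivity)
      rw [inv_le_inv₀ (by positivity) (by positivity)]
      nlinarith
  have hsplit : ∫ y : ℝ, (2.57 + 1 / 2 * Real.log (1 + y ^ 2 / 9)) * ((3 / 2 : ℝ) ^ 2 + y ^ 2)⁻¹ =
      2.57 * (2 * π / 3) + 1 / 2 * ∫ y : ℝ, Real.log (1 + y ^ 2 / 9) * ((3 / 2 : ℝ) ^ 2 + y ^ 2)⁻¹ := by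
    have e2 : (fun y : ℝ ↦ (2.57 + 1 / 2 * Real.log (1 + y ^ 2 / 9)) * ((3 / 2 : ℝ) ^ 2 + y ^ 2)⁻¹) =
        fun y : ℝ ↦ 2.57 * ((3 / 2 : ℝ) ^ 2 + y ^ 2)⁻¹ +
          1 / 2 * (Real.log (1 + y ^ 2 / 9) * ((3 / 2 : ℝ) ^ 2 + y ^ 2)⁻¹) := by
      funext y; ring
    rw [e2, integral_add (hk_int.const_mul _) (hJ'.const_mul _), integral_const_mul,
      integral_const_mul, hk_val]
  -- numerics
  have hπ := Real.pi_gt_d6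
  have hπ' := Real.pi_pos
  have hl2 := Real.log_two_lt_d9
  have hlog4 : Real.log 4 = 2 * Real.log 2 := by
    rw [show (4 : ℝ) = 2 ^ 2 by norm_num, Real.log_pow]; norm_num
  have hlog25 : Real.log (1 + 16 / 9) ≤ 2 * Real.log 2 := by
    rw [← hlog4]; exact Real.log_le_log (by norm_num) (by norm_num)
  have hfrac : (Real.log 4 + 1) / (4 * π) ≤ (2 * 0.6931471808 + 1) / (4 * 3.141592) := by
    rw [hlog4]
    exact div_le_div₀ (by norm_num) (by linarith) (by norm_num) (by linarith)
  refine h0.trans ?_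
  calc D / (2 * π) * ∫ y : ℝ, (2.57 + 1 / 2 * Real.log (1 + y ^ 2 / 9)) * (a ^ 2 + y ^ 2)⁻¹
      ≤ D / (2 * π) * (2.57 * (2 * π / 3) + 1 / 2 * (2 * π / 3 * (2 * Real.log 2) + (Real.log 4 + 1))) := by
        refine mul_le_mul_of_nonneg_left (hmono.trans ?_) (by positivity)
        rw [hsplit]
        have := hJ'val.trans (by gcongr : 2 * π / 3 * Real.log (1 + 16 / 9) + (Real.log 4 + 1) ≤
          2 * π / 3 * (2 * Real.log 2) + (Real.log 4 + 1))
        linarith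
    _ = D * (2.57 / 3 + Real.log 2 / 3 + (Real.log 4 + 1) / (4 * π)) := by
        field_simp
        ring
    _ ≤ 1.28 * D := by
        rw [mul_comm (1.28 : ℝ) D]
        refine mul_le_mul_of_nonneg_left ?_ hD0
        norm_num at hfrac ⊢
        linarith

end remainder

end FordRemainder

end Literature.NumberTheory.LFunctions
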